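import Literature.Topology.FourManifolds.ManolescuPiccirillo2023CensusHolds
import Literature.Topology.FourManifolds.RasmussenConcordanceProofs
import HarnessLib

/-!
# Kegel–Spreer: concordance friends with different sliceness status give an exotic `S⁴`

Citation header. M. Kegel, J. Spreer, *The search for exotic knot traces*, arXiv:2603.22438
(2026), §1 (Introduction) and §1.4 "Concordance friends".  What is reproduced: the two
definitions and the Corollary of §1.4, PROVED over the tree's knot vocabulary from results
already in the tree — Manolescu–Piccirillo's Lemma 3.3 for `W = S⁴`
(`Knot.ManolescuPiccirillo2023_lemma33_sphere_holds`), the FGMW lemma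
(`Knot.exists_exotic_of_isHomotopyBallSlice_not_isSmoothlySlice_holds`) and the invariance of
smooth sliceness under concordance (`Knot.IsConcordant.isSmoothlySlice`, Fox–Milnor).  No fact is
introduced; no knot, diagram or invariant value from the paper's census is asserted.

As printed (friends.tex L144): "We say that two knots in the 3-sphere `S³` are *friends* if they
have diffeomorphic `0`-surgeries."  (L233–239): "We say that two knots `K` and `K'` are
*concordance friends* if there exists a sequence of knots `K = K₁, K₂, K₃, …, K_{n-1}, K_n = K'`
such that for every `i`, the knots `K_i` and `K_{i+1}` are either concordant or friends. Since
concordant knots have the same smooth `4`-genus and thus the same sliceness status, we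
immediately obtain the following.  COROLLARY. If there exist concordance friends with different
sliceness statuses, then there exists a smooth `4`-manifold that is homotopy equivalent to `S⁴`
but not diffeomorphic to `S⁴`."

Rendering.  "Friends" is the tree's `MPCensus.CommonZeroSurgery` (some `3`-manifold is
`0`-surgery on both knots — the diffeomorphism of `0`-surgeries enters only through this common
model, exactly as in `ZeroSurgeryHomotopyBallSlice`); "concordance friends" is the
reflexive–transitive closure of "friends or concordant"; the conclusion is the exotic-`S⁴`
existential of `Knot.exists_exotic_of_isHomotopyBallSlice_not_isSmoothlySlice` (a closed smooth
`4`-manifold homotopy equivalent, not diffeomorphic, to `S⁴`).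
-/

open scoped Manifold ContDiff Topology
open ContinuousMap

noncomputable section

namespace Literature.Topology.FourManifolds

namespace KegelSpreer2026

/-- Two knots are **friends** if they have a common `0`-surgery (Kegel–Spreer: "diffeomorphic
`0`-surgeries"); the tree's `MPCensus.CommonZeroSurgery`. [cite: KegelSpreer2026, §1 (p. 1)] -/
abbrev Friends (K K' : Knot) : Prop :=
  MPCensus.CommonZeroSurgery K K'

/-- One link of a concordance-friend chain: the two knots are friends or concordant.
[cite: KegelSpreer2026, §1.4] -/
def Step (K K' : Knot) : Prop :=
  Friends K K' ∨ K.IsConcordant K'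

/-- **Concordance friends**: joined by a finite chain each of whose consecutive pairs are friends
or concordant (reflexive–transitive closure of `Step`). [cite: KegelSpreer2026, §1.4] -/
def ConcordanceFriends (K K' : Knot) : Prop :=
  Relation.ReflTransGen Step K K'

/-- Friends are concordance friends. [cite: KegelSpreer2026, §1.4] -/
theorem ConcordanceFriends.of_friends {K K' : Knot} (h : Friends K K') :
    ConcordanceFriends K K' :=
  Relation.ReflTransGen.single (Or.inl h)

/-- Concordant knots are concordance friends. [cite: KegelSpreer2026, §1.4] -/
theorem ConcordanceFriends.of_isConcordant {K K' : Knot} (h : K.IsConcordant K') :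
    ConcordanceFriends K K' :=
  Relation.ReflTransGen.single (Or.inr h)

/-- Every knot is a concordance friend of itself (the one-term sequence `K = K₁ = K'` of the printed
definition). [cite: KegelSpreer2026, §1.4 (definition of concordance friends)] -/
theorem ConcordanceFriends.refl (K : Knot) : ConcordanceFriends K K :=
  Relation.ReflTransGen.refl

/-- Concatenating two of the printed sequences gives one: concordance friendship is transitive.
[cite: KegelSpreer2026, §1.4 (definition of concordance friends)] -/
theorem ConcordanceFriends.trans {K K' K'' : Knot} (h : ConcordanceFriends K K')
    (h' : ConcordanceFriends K' K'') : ConcordanceFriends K K'' :=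
  Relation.ReflTransGen.trans h h'

/-- A single link of the printed sequence is symmetric (common `0`-surgery is symmetric; concordance
is symmetric, `equivalence_isConcordant_holds`), so the sequence may be read backwards.
[cite: KegelSpreer2026, §1.4 (definition of concordance friends)] -/
theorem Step.symm {K K' : Knot} (h : Step K K') : Step K' K :=
  h.elim (fun h => Or.inl (MPCensus.CommonZeroSurgery.symm h))
    (fun h => Or.inr (Knot.IsConcordant.symm equivalence_isConcordant_holds h))

/-- Being concordance friends is symmetric (reverse the printed sequence).
[cite: KegelSpreer2026, §1.4 (definition of concordance friends)] -/
theorem ConcordanceFriends.symm {K K' : Knot} (h : ConcordanceFriends K K') :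
    ConcordanceFriends K' K := by
  induction h with
  | refl => exact Relation.ReflTransGen.refl
  | tail _ hstep ih => exact Relation.ReflTransGen.head (Step.symm hstep) ih

/-- Along a concordance the sliceness status does not change (Fox–Milnor; the printed sentence
"concordant knots have the same smooth `4`-genus and thus the same sliceness status").
[cite: KegelSpreer2026, §1.4] -/
theorem isSmoothlySlice_iff_of_isConcordant {K K' : Knot} (h : K.IsConcordant K') :
    K.IsSmoothlySlice ↔ K'.IsSmoothlySlice :=
  ⟨fun hK => Knot.IsConcordant.isSmoothlySlice
      (Knot.IsConcordant.symm equivalence_isConcordant_holds h) hK,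
    fun hK' => Knot.IsConcordant.isSmoothlySlice h hK'⟩

/-- The combinatorial heart of the Corollary: in a chain from a smoothly slice knot to a knot that
is not smoothly slice, some link is a pair of FRIENDS with different sliceness status (the
concordance links cannot flip the status). [cite: KegelSpreer2026, §1.4 (proof of the Corollary)] -/
theorem ConcordanceFriends.exists_friends_flip {K K' : Knot} (h : ConcordanceFriends K K')
    (hK : K.IsSmoothlySlice) (hK' : ¬ K'.IsSmoothlySlice) :
    ∃ (L L' : Knot) (Y : Type) (_ : TopologicalSpace Y)
      (_ : ChartedSpace (EuclideanSpace ℝ (Fin 3)) Y),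
      (FramedLink.single L 0).IsSurgery (𝓡 3) Y ∧ (FramedLink.single L' 0).IsSurgery (𝓡 3) Y ∧
        L.IsSmoothlySlice ∧ ¬ L'.IsSmoothlySlice := by
  induction h with
  | refl => exact absurd hK hK'
  | @tail M N _ hstep ih =>
    by_cases hM : M.IsSmoothlySlice
    · rcases hstep with hfr | hco
      · obtain ⟨Y, _, _, h1, h2⟩ := hfr
        exact ⟨M, N, Y, _, _, h1, h2, hM, hK'⟩
      · exact absurd ((isSmoothlySlice_iff_of_isConcordant hco).1 hM) hK'
    · exact ih hM

/-- **Kegel–Spreer, §1.4, Corollary** (unconditional in the tree): "If there exist concordance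
friends with different sliceness statuses, then there exists a smooth `4`-manifold that is homotopy
equivalent to `S⁴` but not diffeomorphic to `S⁴`."  Here with the slice knot written first; see
`exotic_of_concordanceFriends'` for the other order.  Proof as printed, through Manolescu–Piccirillo
Lemma 3.3 (`W = S⁴`) and the FGMW lemma, both theorems of the tree.
[cite: KegelSpreer2026, §1.4 Corollary] -/
theorem exotic_of_concordanceFriends {K K' : Knot} (h : ConcordanceFriends K K')
    (hK : K.IsSmoothlySlice) (hK' : ¬ K'.IsSmoothlySlice) :
    ∃ (M : Type) (_ : TopologicalSpace M) (_ : T2Space M) (_ : SecondCountableTopology M)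
      (_ : ChartedSpace (EuclideanSpace ℝ (Fin 4)) M) (_ : IsManifold (𝓡 4) ∞ M) (_ : CompactSpace M),
      Nonempty (M ≃ₕ (Metric.sphere (0 : EuclideanSpace ℝ (Fin 5)) 1)) ∧
        IsEmpty (M ≃ₘ⟮𝓡 4, 𝓡 4⟯ (Metric.sphere (0 : EuclideanSpace ℝ (Fin 5)) 1)) := by
  obtain ⟨L, L', Y, _, _, h1, h2, hL, hL'⟩ := h.exists_friends_flip hK hK'
  exact Knot.ManolescuPiccirillo2023_lemma33_sphere.exists_exotic
    Knot.ManolescuPiccirillo2023_lemma33_sphere_holds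
    Knot.exists_exotic_of_isHomotopyBallSlice_not_isSmoothlySlice_holds
    ⟨L, L', Y, _, _, h1, h2, hL, hL'⟩

/-- The Corollary with the non-slice knot written first. [cite: KegelSpreer2026, §1.4 Corollary] -/
theorem exotic_of_concordanceFriends' {K K' : Knot} (h : ConcordanceFriends K K')
    (hK : ¬ K.IsSmoothlySlice) (hK' : K'.IsSmoothlySlice) :
    ∃ (M : Type) (_ : TopologicalSpace M) (_ : T2Space M) (_ : SecondCountableTopology M)
      (_ : ChartedSpace (EuclideanSpace ℝ (Fin 4)) M) (_ : IsManifold (𝓡 4) ∞ M) (_ : CompactSpace M),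
      Nonempty (M ≃ₕ (Metric.sphere (0 : EuclideanSpace ℝ (Fin 5)) 1)) ∧
        IsEmpty (M ≃ₘ⟮𝓡 4, 𝓡 4⟯ (Metric.sphere (0 : EuclideanSpace ℝ (Fin 5)) 1)) :=
  exotic_of_concordanceFriends h.symm hK' hK

/-- The form used by a census row (Kegel–Spreer §7: "If it turns out that one of these examples
is slice, then there exists an exotic `4`-sphere"): a concordance friend `K` of a knot `K'` whose
non-sliceness is certified by a slice obstruction `s` (`MPCensus.SliceObstruction s`, e.g.
Rasmussen's `s ≠ 0`) turns a slice certificate for `K` into an exotic `S⁴`.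
[cite: KegelSpreer2026, §7 (last paragraph) with §1.4 Corollary] -/
theorem exotic_of_concordanceFriends_of_sliceObstruction {s : Knot → ℤ}
    (hs : MPCensus.SliceObstruction s) {K K' : Knot} (h : ConcordanceFriends K K')
    (hK : K.IsSmoothlySlice) (hK' : s K' ≠ 0) :
    ∃ (M : Type) (_ : TopologicalSpace M) (_ : T2Space M) (_ : SecondCountableTopology M)
      (_ : ChartedSpace (EuclideanSpace ℝ (Fin 4)) M) (_ : IsManifold (𝓡 4) ∞ M) (_ : CompactSpace M),
      Nonempty (M ≃ₕ (Metric.sphere (0 : EuclideanSpace ℝ (Fin 5)) 1)) ∧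
        IsEmpty (M ≃ₘ⟮𝓡 4, 𝓡 4⟯ (Metric.sphere (0 : EuclideanSpace ℝ (Fin 5)) 1)) :=
  exotic_of_concordanceFriends h hK (fun h' => hK' (hs K' h'))

/-- Sanity: a single friendship is the Manolescu–Piccirillo census situation
(`MPCensus.exotic_of_flagged_pair`, now hypothesis-free). [cite: KegelSpreer2026, §1 (p. 1)] -/
theorem exotic_of_friends {K K' : Knot} (h : Friends K K') (hK : K.IsSmoothlySlice)
    (hK' : ¬ K'.IsSmoothlySlice) :
    ∃ (M : Type) (_ : TopologicalSpace M) (_ : T2Space M) (_ : SecondCountableTopology M)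
      (_ : ChartedSpace (EuclideanSpace ℝ (Fin 4)) M) (_ : IsManifold (𝓡 4) ∞ M) (_ : CompactSpace M),
      Nonempty (M ≃ₕ (Metric.sphere (0 : EuclideanSpace ℝ (Fin 5)) 1)) ∧
        IsEmpty (M ≃ₘ⟮𝓡 4, 𝓡 4⟯ (Metric.sphere (0 : EuclideanSpace ℝ (Fin 5)) 1)) :=
  exotic_of_concordanceFriends (ConcordanceFriends.of_friends h) hK hK'

end KegelSpreer2026

end Literature.Topology.FourManifolds

end
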